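import Summits.BirchSwinnertonDyer.BirchSwinnertonDyer.Theorems.ByReductionTypeAtTwoTowerTorsionCertificateFrobenius
import HarnessLib

/-!
# The TWO-ELEMENT torsion certificate: `#E[2^∞]^{Gal(ℚ̄/ℚ_j)} ≤ 2` when the halving discriminant
# `r = ψ₂′(e₁)/4 = ρ²` IS a rational square (rational cyclic `4`-isogeny), from TWO Frobenius primes
# (route ByReductionTypeAtTwo, items 19577 / 19573; seat bsd-2adic-ord-3 GEN 7)

HONEST FRAMING (cell `bsd-2adic`, run/shared/lean/pub/bsd-2adic/, HUMAN RULINGS D-0036 / D-0054 / D-0074): THEOREMS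
ONLY; nothing asserted; no definition; no named fact; closes nothing by itself.

WHY. GEN 6's one-element certificate (`TowerLambdaTorsion.natCard_fixedBy_layerSubgroup_le_two[_of_prime]`,
`Theorems/ByReductionTypeAtTwoTowerTorsionCertificate[Frobenius].lean`) needs ONE `σ` moving `√r` AND `√s`. When
`r = ρ²` with `ρ ∈ ℚ` (the rational `2`-torsion point `T = (e₁, ·)` generates a rational cyclic `4`-isogeny:
the halves `±P₊, ±P₋` of `T` have the RATIONAL abscissae `x(P_±) = e₁ ± ρ`), no such `σ` exists: `4 ∣ #Ẽ(𝔽_ℓ)` at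
every good odd `ℓ`, so EVERY `σ ∈ Γ_ℚ` fixes at least four points of `E[2^∞]` (Chebotarev). But two elements do
it: with `u_± = ψ₂(e₁ ± ρ)` (`ψ₂(X) = 4X³ + b₂X² + 2b₄X + b₆`, so `(2y + a₁x + a₃)² = ψ₂(x)` on the curve, and
`y(P_±) ∈ ℚ(√u_±)`), a `σ` moving `√u₊` and `√u₋` fixes none of the four halves of `T`, and a `τ` moving `√s`
fixes no `2`-torsion point other than `O, T`; a point of `E[2^∞]` fixed by BOTH is then `O` or `T`
(§2, the GEN 6 induction verbatim: `2^{k−1}m` is a common fixed point of order `2`, hence `T`; if `k ≥ 2`,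
`2^{k−2}m` is a common fixed half of `T`). §3 packages the two elements as Frobenius elements at odd primes
`ℓ₁, ℓ₂` with `j + 3 ≤ v₂(ℓᵢ² − 1)` (tower-1's norm formula, GEN 6 `exists_mem_layerSubgroup_apply_ne`) and
`ℓ₁ ∣ u₊^{⌊ℓ₁/2⌋} + 1`, `ℓ₁ ∣ u₋^{⌊ℓ₁/2⌋} + 1`, `ℓ₂ ∣ s^{⌊ℓ₂/2⌋} + 1` (Euler): FIVE decidable integer facts.
(No single prime can serve: `u₊u₋ ≡ s` modulo squares.) First consumers: the INELIG classes 117925d, 367575bo,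
74025w (`E(ℚ)_tors ≅ ℤ/2`, `r` a square), whose `λ`-road rank certificate needs `t = 1`.
References: [SilvermanAEC2009] III.2.3 (d), III Ex. 3.7, VIII.§1; [Washington1997] §13.1; [IrelandRosen1990]
Prop. 5.1.1; [NeukirchANT1999] Ch. I §9.
-/

set_option autoImplicit false
-- the sub-problem namespace repeats the summit name by design (D-0017 nested layout)
set_option linter.dupNamespace false

noncomputable section

open scoped Classical

open Polynomial NumberField IsDedekindDomain WeierstrassCurve Literature.NumberTheory.EllipticCurves
  Rat.HeightOneSpectrum

namespace Summit.BirchSwinnertonDyer.BirchSwinnertonDyer.Theorems.TowerLambdaTorsion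

/-! ## §1 Two algebraic identities -/

section Coordinates

variable {F : Type*} [Field F] {K : Type*} [Field K] [Algebra F K] (V : WeierstrassCurve F)

/-- A point fixed by a Galois automorphism has a fixed `y`-coordinate. [folklore] -/
theorem algEquiv_y_eq_of_map_eq (σ : K ≃ₐ[F] K) {x y : K} {h : (V.baseChange K).toAffine.Nonsingular x y}
    (hfix : Affine.Point.map (σ : K →ₐ[F] K) (Affine.Point.some x y h) = Affine.Point.some x y h) : σ y = y := by
  simp only [Affine.Point.map_some, Affine.Point.some.injEq] at hfix
  simpa using hfix.2

end Coordinates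

section Algebra

variable {K : Type*} [Field K] (V : WeierstrassCurve K)

/-- On the curve, `(2y + a₁x + a₃)² = ψ₂(x) = 4x³ + b₂x² + 2b₄x + b₆`. [cite: SilvermanAEC2009, III.2.3 (d)] -/
theorem sq_twoTorsionY_eq {x y : K} (heq : y ^ 2 + V.a₁ * x * y + V.a₃ * y = x ^ 3 + V.a₂ * x ^ 2 + V.a₄ * x + V.a₆) :
    (2 * y + V.a₁ * x + V.a₃) ^ 2 = 4 * x ^ 3 + V.b₂ * x ^ 2 + 2 * V.b₄ * x + V.b₆ := by
  simp only [WeierstrassCurve.b₂, WeierstrassCurve.b₄, WeierstrassCurve.b₆]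
  linear_combination (4 : K) * heq

/-- `a² = b²` in a field forces `a = b` or `a = −b`. [folklore] -/
theorem eq_or_eq_neg_of_sq_eq_sq' {a b : K} (h : a ^ 2 = b ^ 2) : a = b ∨ a = -b := by
  have h0 : (a - b) * (a + b) = 0 := by linear_combination h
  rcases mul_eq_zero.mp h0 with h1 | h1
  · exact Or.inl (sub_eq_zero.mp h1)
  · exact Or.inr (eq_neg_of_add_eq_zero_left h1)

end Algebra

/-! ## §2 Two Galois elements: one moving the halves of `T`, one moving `E[2] ∖ {O, T}` -/

section Galois

variable (W : WeierstrassCurve ℚ)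

/-- **Two Galois elements fixing in common at most `{O, T}` in `E(ℚ̄)[2^∞]`, square-`r` case.** Data: a
rational `2`-torsion abscissa `e₁` (`ψ₂(e₁) = 0`), `ρ ∈ ℚ` with `2ρ² = ψ₂′(e₁)/2` (i.e. `r = ρ²`), the resolvent
discriminant `s`, and `u = ψ₂(e₁ + ρ)`, `v = ψ₂(e₁ − ρ)`; hypotheses: `σ` fixes no square root of `u` and none of
`v`, `τ` fixes no square root of `s`. Conclusion: any two nonzero points of `E(ℚ̄)[2^∞]` fixed by `σ` AND `τ`
are equal. Proof = GEN 6's `eq_of_smul_eq_of_smul_eq` with step (ii) replaced: a common fixed `P` with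
`2P = T` has `(x(P) − e₁)² = ρ²`, so `x(P) = e₁ ± ρ` and `2y(P) + a₁x(P) + a₃` is a `σ`-fixed square root of
`u` resp. `v`. [cite: SilvermanAEC2009, III.2.3 (d), III Ex. 3.7 and VIII.§1] -/
theorem eq_of_smul_eq_of_smul_eq_of_sq (σ τ : Field.absoluteGaloisGroup ℚ) (e₁ ρ s u v : ℚ)
    (he₁ : 4 * e₁ ^ 3 + W.b₂ * e₁ ^ 2 + 2 * W.b₄ * e₁ + W.b₆ = 0)
    (hρ : 2 * ρ ^ 2 = W.a₁ ^ 2 * e₁ + W.a₁ * W.a₃ + 4 * W.a₂ * e₁ + 2 * W.a₄ + 6 * e₁ ^ 2)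
    (hs : s = (W.b₂ + 4 * e₁) ^ 2 - 16 * (2 * W.b₄ + W.b₂ * e₁ + 4 * e₁ ^ 2))
    (hu : u = 4 * (e₁ + ρ) ^ 3 + W.b₂ * (e₁ + ρ) ^ 2 + 2 * W.b₄ * (e₁ + ρ) + W.b₆)
    (hv : v = 4 * (e₁ - ρ) ^ 3 + W.b₂ * (e₁ - ρ) ^ 2 + 2 * W.b₄ * (e₁ - ρ) + W.b₆)
    (hσu : ∀ β : AlgebraicClosure ℚ, β ^ 2 = algebraMap ℚ (AlgebraicClosure ℚ) u →
      (show AlgebraicClosure ℚ ≃ₐ[ℚ] AlgebraicClosure ℚ from σ) β ≠ β)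
    (hσv : ∀ β : AlgebraicClosure ℚ, β ^ 2 = algebraMap ℚ (AlgebraicClosure ℚ) v →
      (show AlgebraicClosure ℚ ≃ₐ[ℚ] AlgebraicClosure ℚ from σ) β ≠ β)
    (hτs : ∀ β : AlgebraicClosure ℚ, β ^ 2 = algebraMap ℚ (AlgebraicClosure ℚ) s →
      (show AlgebraicClosure ℚ ≃ₐ[ℚ] AlgebraicClosure ℚ from τ) β ≠ β)
    {m m' : geomPrimaryTorsion W 2} (hσm : σ • m = m) (hτm : τ • m = m) (hm0 : m ≠ 0)
    (hσm' : σ • m' = m') (hτm' : τ • m' = m') (hm0' : m' ≠ 0) : m = m' := by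
  -- notation: the algebraic closure, `σ`, `τ` as field automorphisms, the base-changed curve
  set Kb := AlgebraicClosure ℚ
  set σ' : Kb ≃ₐ[ℚ] Kb := σ with hσ'
  set τ' : Kb ≃ₐ[ℚ] Kb := τ with hτ'
  set V : WeierstrassCurve Kb := W.baseChange Kb with hVdef
  have hV2 : (2 : Kb) ≠ 0 := two_ne_zero
  -- the rational data pushed to `Kb`
  set E₁ : Kb := algebraMap ℚ Kb e₁ with hE₁
  set R : Kb := algebraMap ℚ Kb ρ with hR
  have hVa₁ : V.a₁ = algebraMap ℚ Kb W.a₁ := rfl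
  have hVa₂ : V.a₂ = algebraMap ℚ Kb W.a₂ := rfl
  have hVa₃ : V.a₃ = algebraMap ℚ Kb W.a₃ := rfl
  have hVa₄ : V.a₄ = algebraMap ℚ Kb W.a₄ := rfl
  have hVb₂ : V.b₂ = algebraMap ℚ Kb W.b₂ := by rw [hVdef, WeierstrassCurve.baseChange, map_b₂]
  have hVb₄ : V.b₄ = algebraMap ℚ Kb W.b₄ := by rw [hVdef, WeierstrassCurve.baseChange, map_b₄]
  have hVb₆ : V.b₆ = algebraMap ℚ Kb W.b₆ := by rw [hVdef, WeierstrassCurve.baseChange, map_b₆]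
  have he₁K : 4 * E₁ ^ 3 + V.b₂ * E₁ ^ 2 + 2 * V.b₄ * E₁ + V.b₆ = 0 := by
    have h := congrArg (algebraMap ℚ Kb) he₁
    rw [map_zero] at h
    rw [← h, hVb₂, hVb₄, hVb₆, hE₁]
    simp only [map_add, map_mul, map_pow, map_ofNat]
  have hρK : 2 * R ^ 2 = V.a₁ ^ 2 * E₁ + V.a₁ * V.a₃ + 4 * V.a₂ * E₁ + 2 * V.a₄ + 6 * E₁ ^ 2 := by
    have h := congrArg (algebraMap ℚ Kb) hρ
    rw [hVa₁, hVa₂, hVa₃, hVa₄, hE₁, hR]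
    simpa only [map_add, map_mul, map_pow, map_ofNat] using h
  have hsK : algebraMap ℚ Kb s = (V.b₂ + 4 * E₁) ^ 2 - 16 * (2 * V.b₄ + V.b₂ * E₁ + 4 * E₁ ^ 2) := by
    rw [hs, hVb₂, hVb₄, hE₁]
    simp only [map_add, map_sub, map_mul, map_pow, map_ofNat]
  have huK : algebraMap ℚ Kb u = 4 * (E₁ + R) ^ 3 + V.b₂ * (E₁ + R) ^ 2 + 2 * V.b₄ * (E₁ + R) + V.b₆ := by
    rw [hu, hVb₂, hVb₄, hVb₆, hE₁, hR]
    simp only [map_add, map_mul, map_pow, map_ofNat]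
  have hvK : algebraMap ℚ Kb v = 4 * (E₁ - R) ^ 3 + V.b₂ * (E₁ - R) ^ 2 + 2 * V.b₄ * (E₁ - R) + V.b₆ := by
    rw [hv, hVb₂, hVb₄, hVb₆, hE₁, hR]
    simp only [map_add, map_sub, map_mul, map_pow, map_ofNat]
  -- the actions on the ambient points are `Point.map σ'`, `Point.map τ'`, commuting with `n • ·`
  have hactσ : ∀ P : geomPoints W, σ • P = Affine.Point.map (σ' : Kb →ₐ[ℚ] Kb) P := fun P ↦ rfl
  have hactτ : ∀ P : geomPoints W, τ • P = Affine.Point.map (τ' : Kb →ₐ[ℚ] Kb) P := fun P ↦ rfl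
  have hact' : ∀ (g : Field.absoluteGaloisGroup ℚ) (n : ℕ) (P : geomPoints W), g • (n • P) = n • (g • P) :=
    fun g n P ↦ map_nsmul (DistribSMul.toAddMonoidHom (geomPoints W) g) n P
  -- STEP (i): a nonzero `τ`-fixed `2`-torsion point has `x = e₁`
  have step_i : ∀ {x y : Kb} {h : V.toAffine.Nonsingular x y},
      Affine.Point.map (τ' : Kb →ₐ[ℚ] Kb) (Affine.Point.some x y h) = Affine.Point.some x y h →
      Affine.Point.some x y h + Affine.Point.some x y h = 0 →
      x = E₁ ∧ y = V.toAffine.negY x y := by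
    intro x y h hfix h2
    obtain ⟨hy, hroot⟩ := V.isRoot_twoTorsionPolynomial_of_add_self_eq_zero h2
    have hg : 4 * x ^ 3 + V.b₂ * x ^ 2 + 2 * V.b₄ * x + V.b₆ = 0 := by
      simpa only [twoTorsionPolynomial, Cubic.toPoly, IsRoot.def, eval_add, eval_mul, eval_C, eval_pow,
        eval_X] using hroot
    have hτx : τ' x = x := algEquiv_x_eq_of_map_eq W τ' hfix
    refine ⟨?_, hy⟩
    by_contra hne
    -- `x` is a root of the quadratic cofactor
    have hfac := twoTorsionCubic_sub_eq_mul V.b₂ V.b₄ V.b₆ E₁ x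
    rw [hg, he₁K, sub_zero] at hfac
    have hquad : 4 * x ^ 2 + (V.b₂ + 4 * E₁) * x + (2 * V.b₄ + V.b₂ * E₁ + 4 * E₁ ^ 2) = 0 := by
      rcases mul_eq_zero.mp hfac.symm with h0 | h0
      · exact absurd (sub_eq_zero.mp h0) hne
      · exact h0
    have hβ := sq_eq_disc_of_quadratic_eq_zero hquad
    -- `β = 8x + B` is fixed by `τ` and squares to `s`
    refine hτs (8 * x + (V.b₂ + 4 * E₁)) (by rw [hβ, hsK]) ?_
    change τ' (8 * x + (V.b₂ + 4 * E₁)) = 8 * x + (V.b₂ + 4 * E₁)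
    rw [hVb₂, hE₁]
    simp only [map_add, map_mul, map_ofNat, hτx, AlgEquiv.commutes]
  -- STEP (ii): no `σ`-fixed `P` doubles onto a point of order `2` with abscissa `e₁`
  have step_ii : ∀ {x y : Kb} {h : V.toAffine.Nonsingular x y} {y' : Kb} {h' : V.toAffine.Nonsingular E₁ y'},
      Affine.Point.map (σ' : Kb →ₐ[ℚ] Kb) (Affine.Point.some x y h) = Affine.Point.some x y h →
      y' = V.toAffine.negY E₁ y' →
      Affine.Point.some x y h + Affine.Point.some x y h = Affine.Point.some E₁ y' h' → False := by
    intro x y h y' h' hfix hy' h2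
    have hσx : σ' x = x := algEquiv_x_eq_of_map_eq W σ' hfix
    have hσy : σ' y = y := algEquiv_y_eq_of_map_eq W σ' hfix
    -- `P` is not of order `2`
    have hy : y ≠ V.toAffine.negY x y := by
      intro hy
      rw [Affine.Point.add_self_of_Y_eq (h₁ := h) hy] at h2
      exact Affine.Point.some_ne_zero _ h2.symm
    rw [Affine.Point.add_self_of_Y_ne hy] at h2
    injection h2 with hX _
    -- the duplication identity measured from `e₁`
    have heq : y ^ 2 + V.a₁ * x * y + V.a₃ * y = x ^ 3 + V.a₂ * x ^ 2 + V.a₄ * x + V.a₆ :=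
      (Affine.equation_iff _ _).mp h.left
    have heq' : y' ^ 2 + V.a₁ * E₁ * y' + V.a₃ * y' = E₁ ^ 3 + V.a₂ * E₁ ^ 2 + V.a₄ * E₁ + V.a₆ :=
      (Affine.equation_iff _ _).mp h'.left
    have hT' : y' = -y' - V.a₁ * E₁ - V.a₃ := hy'
    have hD : y - (-y - V.a₁ * x - V.a₃) ≠ 0 := sub_ne_zero.mpr hy
    have hℓ : V.toAffine.slope x x y y * (y - (-y - V.a₁ * x - V.a₃)) =
        3 * x ^ 2 + 2 * V.a₂ * x + V.a₄ - V.a₁ * y := by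
      rw [Affine.slope_of_Y_ne rfl hy]
      exact div_mul_cancel₀ _ hD
    have key := V.toAffine.four_mul_addX_self_sub_mul_sq heq heq' hT' hℓ
    rw [hX, sub_self, mul_zero, zero_mul] at key
    have hsq : 2 * (x - E₁) ^ 2 = V.a₁ ^ 2 * E₁ + V.a₁ * V.a₃ + 4 * V.a₂ * E₁ + 2 * V.a₄ + 6 * E₁ ^ 2 :=
      sub_eq_zero.mp (pow_eq_zero_iff two_ne_zero |>.mp key.symm)
    -- `(x − e₁)² = ρ²`, so `x = e₁ ± ρ`
    have hxR : (x - E₁) ^ 2 = R ^ 2 := mul_left_cancel₀ hV2 (hsq.trans hρK.symm)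
    -- `β = 2y + a₁x + a₃` is `σ`-fixed and squares to `ψ₂(x)`
    have hβ := sq_twoTorsionY_eq V heq
    have hβfix : σ' (2 * y + V.a₁ * x + V.a₃) = 2 * y + V.a₁ * x + V.a₃ := by
      rw [hVa₁, hVa₃]
      simp only [map_add, map_mul, map_ofNat, hσx, hσy, AlgEquiv.commutes]
    rcases eq_or_eq_neg_of_sq_eq_sq' hxR with hx | hx
    · have hx' : x = E₁ + R := by linear_combination hx
      refine hσu (2 * y + V.a₁ * x + V.a₃) ?_ hβfix
      rw [hβ, huK, hx']
    · have hx' : x = E₁ - R := by linear_combination hx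
      refine hσv (2 * y + V.a₁ * x + V.a₃) ?_ hβfix
      rw [hβ, hvK, hx']
  -- STEP (iii): every nonzero common fixed `m ∈ E[2^∞]` is the point `(e₁, −(a₁e₁+a₃)/2)`
  have step_iii : ∀ {m : geomPrimaryTorsion W 2}, σ • m = m → τ • m = m → m ≠ 0 →
      ∃ (y : Kb) (h : V.toAffine.Nonsingular E₁ y), y = V.toAffine.negY E₁ y ∧
        (m : geomPoints W) = Affine.Point.some E₁ y h := by
    intro m hσm hτm hm0
    have hσfixm : σ • (m : geomPoints W) = m := by rw [← primaryComponent.coe_smul, hσm]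
    have hτfixm : τ • (m : geomPoints W) = m := by rw [← primaryComponent.coe_smul, hτm]
    have hex : ∃ k : ℕ, 2 ^ k • (m : geomPoints W) = 0 := m.2
    have hk : 2 ^ Nat.find hex • (m : geomPoints W) = 0 := Nat.find_spec hex
    have hk0 : Nat.find hex ≠ 0 := by
      intro h0
      rw [h0, pow_zero, one_nsmul] at hk
      exact hm0 (Subtype.ext hk)
    have hk1le : 1 ≤ Nat.find hex := Nat.one_le_iff_ne_zero.mpr hk0
    -- `U = 2^(k-1) m` has exact order `2` and is fixed by `τ`
    set U : geomPoints W := 2 ^ (Nat.find hex - 1) • (m : geomPoints W) with hU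
    have hU0 : U ≠ 0 := fun h0 ↦ Nat.find_min hex (m := Nat.find hex - 1) (by omega) h0
    have hU2 : U + U = 0 := by
      have h1 : 2 ^ (Nat.find hex - 1 + 1) • (m : geomPoints W) = 0 := by rwa [Nat.sub_add_cancel hk1le]
      rwa [two_pow_succ_nsmul] at h1
    have hUfix : τ • U = U := by rw [hU, hact', hτfixm]
    obtain ⟨xU, yU, hUns, hUeq⟩ := exists_eq_some_of_ne_zero W (K := Kb) hU0
    rw [hUeq, hactτ] at hUfix
    rw [hUeq] at hU2
    obtain ⟨hxU, hyU⟩ := step_i hUfix hU2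
    subst hxU
    -- `k = 1`: otherwise `P = 2^(k-2) m` halves `U` and is fixed by `σ`
    have hk1 : Nat.find hex = 1 := by
      by_contra hk1
      have hk2 : 2 ≤ Nat.find hex := by omega
      set P : geomPoints W := 2 ^ (Nat.find hex - 2) • (m : geomPoints W) with hP
      have hPfix : σ • P = P := by rw [hP, hact', hσfixm]
      have hPP : P + P = U := by
        rw [hU, hP, ← two_pow_succ_nsmul, show Nat.find hex - 2 + 1 = Nat.find hex - 1 by omega]
      have hP0 : P ≠ 0 := by
        intro h0
        rw [h0, add_zero] at hPP
        exact hU0 hPP.symm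
      obtain ⟨xP, yP, hPns, hPeq⟩ := exists_eq_some_of_ne_zero W (K := Kb) hP0
      rw [hPeq, hactσ] at hPfix
      rw [hPeq, hUeq] at hPP
      exact step_ii hPfix hyU hPP
    -- so `m = U`
    have hmU : (m : geomPoints W) = U := by
      rw [hU, hk1]
      simp
    exact ⟨yU, hUns, hyU, hmU.trans hUeq⟩
  -- conclusion: two nonzero common fixed points coincide
  obtain ⟨y, h, hy, hmeq⟩ := step_iii hσm hτm hm0
  obtain ⟨y', h', hy', hmeq'⟩ := step_iii hσm' hτm' hm0'
  have hyy : y = y' := by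
    change y = -y - V.a₁ * E₁ - V.a₃ at hy
    change y' = -y' - V.a₁ * E₁ - V.a₃ at hy'
    have h2 : (2 : Kb) * (y - y') = 0 := by linear_combination hy - hy'
    exact sub_eq_zero.mp ((mul_eq_zero.mp h2).resolve_left hV2)
  subst hyy
  apply Subtype.ext
  rw [hmeq, hmeq']

/-- **The layer-`j` torsion certificate `t = 1` from TWO Galois elements of `Gal(ℚ̄/ℚ_j)`** (square-`r` case):
`σ, τ ∈ κ.layerSubgroup j`, `σ` moving every square root of `u = ψ₂(e₁ + ρ)` and of `v = ψ₂(e₁ − ρ)`, `τ`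
moving every square root of `s` ⇒ `#{m ∈ E[2^∞] : Gal(ℚ̄/ℚ_j) · m = m} ≤ 2^1` — the `htor` input of
`towerRank_of_layerClasses_of_torsion` and of the torsion-tolerant gap doors.
[cite: SilvermanAEC2009, III.2.3 (d), VIII.§1] [cite: GreenbergLNM1716, §4 Lemma 4.3] -/
theorem natCard_fixedBy_layerSubgroup_le_two_of_sq {κ : ZpExtension ℚ 2} {j : ℕ}
    (σ τ : Field.absoluteGaloisGroup ℚ) (hσ : σ ∈ κ.layerSubgroup j) (hτ : τ ∈ κ.layerSubgroup j)
    (e₁ ρ s u v : ℚ)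
    (he₁ : 4 * e₁ ^ 3 + W.b₂ * e₁ ^ 2 + 2 * W.b₄ * e₁ + W.b₆ = 0)
    (hρ : 2 * ρ ^ 2 = W.a₁ ^ 2 * e₁ + W.a₁ * W.a₃ + 4 * W.a₂ * e₁ + 2 * W.a₄ + 6 * e₁ ^ 2)
    (hs : s = (W.b₂ + 4 * e₁) ^ 2 - 16 * (2 * W.b₄ + W.b₂ * e₁ + 4 * e₁ ^ 2))
    (hu : u = 4 * (e₁ + ρ) ^ 3 + W.b₂ * (e₁ + ρ) ^ 2 + 2 * W.b₄ * (e₁ + ρ) + W.b₆)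
    (hv : v = 4 * (e₁ - ρ) ^ 3 + W.b₂ * (e₁ - ρ) ^ 2 + 2 * W.b₄ * (e₁ - ρ) + W.b₆)
    (hσu : ∀ β : AlgebraicClosure ℚ, β ^ 2 = algebraMap ℚ (AlgebraicClosure ℚ) u →
      (show AlgebraicClosure ℚ ≃ₐ[ℚ] AlgebraicClosure ℚ from σ) β ≠ β)
    (hσv : ∀ β : AlgebraicClosure ℚ, β ^ 2 = algebraMap ℚ (AlgebraicClosure ℚ) v →
      (show AlgebraicClosure ℚ ≃ₐ[ℚ] AlgebraicClosure ℚ from σ) β ≠ β)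
    (hτs : ∀ β : AlgebraicClosure ℚ, β ^ 2 = algebraMap ℚ (AlgebraicClosure ℚ) s →
      (show AlgebraicClosure ℚ ≃ₐ[ℚ] AlgebraicClosure ℚ from τ) β ≠ β) :
    Nat.card {m : geomPrimaryTorsion W 2 | ∀ g ∈ κ.layerSubgroup j, g • m = m} ≤ 2 ^ 1 := by
  rw [pow_one]
  -- `m ↦ [m = 0]` is injective on the layer-fixed points
  let f : {m : geomPrimaryTorsion W 2 | ∀ g ∈ κ.layerSubgroup j, g • m = m} → Bool :=
    fun m ↦ decide (m.1 = 0)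
  have hf : Function.Injective f := by
    intro a b hab
    have hab' : (a.1 = 0 ↔ b.1 = 0) := by simpa [f] using hab
    by_cases ha : a.1 = 0
    · exact Subtype.ext (ha.trans (hab'.mp ha).symm)
    · have hb : b.1 ≠ 0 := fun hb ↦ ha (hab'.mpr hb)
      exact Subtype.ext (eq_of_smul_eq_of_smul_eq_of_sq W σ τ e₁ ρ s u v he₁ hρ hs hu hv hσu hσv hτs
        (a.2 σ hσ) (a.2 τ hτ) ha (b.2 σ hσ) (b.2 τ hτ) hb)
  simpa using Nat.card_le_card_of_injective f hf

/-! ## §3 The two Galois elements as Frobenius elements: five integer facts -/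

/-- **`#E[2^∞]^{Gal(ℚ̄/ℚ_j)} ≤ 2^1` from TWO odd primes `ℓ₁, ℓ₂`**, square-`r` case, for `W/ℚ` with a rational
`2`-torsion abscissa `e₁` and `ρ ∈ ℚ` with `2ρ² = ψ₂′(e₁)/2`: if `j + 3 ≤ v₂(ℓᵢ² − 1)` (`i = 1, 2`),
`ℓ₁ ∣ u^{⌊ℓ₁/2⌋} + 1`, `ℓ₁ ∣ v^{⌊ℓ₁/2⌋} + 1` for the INTEGERS `u = ψ₂(e₁ + ρ)`, `v = ψ₂(e₁ − ρ)`, and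
`ℓ₂ ∣ s^{⌊ℓ₂/2⌋} + 1` for the resolvent discriminant `s`, then at most two points of `E(ℚ̄)[2^∞]` are fixed by
`Gal(ℚ̄/ℚ_j)`. (`ℓ₁ = ℓ₂` is allowed by the statement but never satisfiable: `uv ≡ s` modulo squares.)
[cite: SilvermanAEC2009, III.2.3 (d), VIII.§1] [cite: Washington1997, §13.1] [cite: IrelandRosen1990, Prop. 5.1.1] -/
theorem natCard_fixedBy_layerSubgroup_le_two_of_two_primes (W : WeierstrassCurve ℚ) {κ : ZpExtension ℚ 2}
    (hκ : κ.IsCyclotomic) {j : ℕ} (v₁ v₂ : HeightOneSpectrum (𝓞 ℚ)) {ℓ₁ ℓ₂ : ℕ}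
    (hv₁ : natGenerator v₁ = ℓ₁) (hv₂ : natGenerator v₂ = ℓ₂) (hℓ₁ : ℓ₁ ≠ 2) (hℓ₂ : ℓ₂ ≠ 2)
    (hj₁ : j + 3 ≤ padicValNat 2 (ℓ₁ ^ 2 - 1)) (hj₂ : j + 3 ≤ padicValNat 2 (ℓ₂ ^ 2 - 1))
    (e₁ ρ : ℚ) (s u v : ℤ)
    (he₁ : 4 * e₁ ^ 3 + W.b₂ * e₁ ^ 2 + 2 * W.b₄ * e₁ + W.b₆ = 0)
    (hρ : 2 * ρ ^ 2 = W.a₁ ^ 2 * e₁ + W.a₁ * W.a₃ + 4 * W.a₂ * e₁ + 2 * W.a₄ + 6 * e₁ ^ 2)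
    (hs : (s : ℚ) = (W.b₂ + 4 * e₁) ^ 2 - 16 * (2 * W.b₄ + W.b₂ * e₁ + 4 * e₁ ^ 2))
    (hu : (u : ℚ) = 4 * (e₁ + ρ) ^ 3 + W.b₂ * (e₁ + ρ) ^ 2 + 2 * W.b₄ * (e₁ + ρ) + W.b₆)
    (hv : (v : ℚ) = 4 * (e₁ - ρ) ^ 3 + W.b₂ * (e₁ - ρ) ^ 2 + 2 * W.b₄ * (e₁ - ρ) + W.b₆)
    (huE : (ℓ₁ : ℤ) ∣ u ^ (ℓ₁ / 2) + 1) (hvE : (ℓ₁ : ℤ) ∣ v ^ (ℓ₁ / 2) + 1)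
    (hsE : (ℓ₂ : ℤ) ∣ s ^ (ℓ₂ / 2) + 1) :
    Nat.card {m : geomPrimaryTorsion W 2 | ∀ g ∈ κ.layerSubgroup j, g • m = m} ≤ 2 ^ 1 := by
  obtain ⟨σ, hσ, hσu, hσv⟩ := exists_mem_layerSubgroup_apply_ne hκ v₁ hv₁ hℓ₁ hj₁ huE hvE
  obtain ⟨τ, hτ, hτs, -⟩ := exists_mem_layerSubgroup_apply_ne hκ v₂ hv₂ hℓ₂ hj₂ hsE hsE
  exact natCard_fixedBy_layerSubgroup_le_two_of_sq W σ τ hσ hτ e₁ ρ s u v he₁ hρ hs hu hv hσu hσv hτs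

end Galois

/-! ## §4 A certificate at a higher layer serves every lower layer -/

section Mono

variable (W : WeierstrassCurve ℚ)

/-- **Layer monotonicity of the torsion certificate.** `Gal(ℚ̄/ℚ_{j'}) ⊆ Gal(ℚ̄/ℚ_j)` for `j ≤ j'`
(`κ.layerSubgroup_antitone`), so a point fixed by `Gal(ℚ̄/ℚ_j)` is fixed by `Gal(ℚ̄/ℚ_{j'})`:
`#E[2^∞]^{Gal(ℚ̄/ℚ_j)} ≤ #E[2^∞]^{Gal(ℚ̄/ℚ_{j'})} ≤ 2^t` — a certificate at layer `j'` (one prime `ℓ` with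
`j' + 3 ≤ v₂(ℓ² − 1)`, or two) is a certificate at every layer `j ≤ j'`, e.g. for a gap door `(j, J)` below the
rank layer `j'`. Finiteness of `E(ℚ_∞)[2^∞]` (`hfin`, Greenberg's `hB` per `κ`) makes the cardinalities honest.
[cite: Washington1997, §13.1] [cite: GreenbergLNM1716, §4 Lemma 4.3] -/
theorem natCard_fixedBy_layerSubgroup_le_of_le {κ : ZpExtension ℚ 2} {j j' t : ℕ} (hjj' : j ≤ j')
    (hfin : Finite (FixedPoints.addSubgroup κ.kerSubgroup (geomPrimaryTorsion W 2)))
    (h : Nat.card {m : geomPrimaryTorsion W 2 | ∀ τ ∈ κ.layerSubgroup j', τ • m = m} ≤ 2 ^ t) :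
    Nat.card {m : geomPrimaryTorsion W 2 | ∀ τ ∈ κ.layerSubgroup j, τ • m = m} ≤ 2 ^ t := by
  haveI : Finite {m : geomPrimaryTorsion W 2 | ∀ τ ∈ κ.layerSubgroup j', τ • m = m} := by
    refine Finite.of_injective (fun m : {m : geomPrimaryTorsion W 2 | ∀ τ ∈ κ.layerSubgroup j', τ • m = m} ↦
      (⟨m.1, ?_⟩ : FixedPoints.addSubgroup κ.kerSubgroup (geomPrimaryTorsion W 2))) ?_
    · rw [FixedPoints.mem_addSubgroup]
      rintro ⟨τ, hτ⟩
      rw [Subgroup.mk_smul]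
      exact m.2 τ (κ.kerSubgroup_le_layerSubgroup j' hτ)
    · intro a b hab
      exact Subtype.ext (congrArg (fun x : FixedPoints.addSubgroup κ.kerSubgroup (geomPrimaryTorsion W 2) ↦
        (x : geomPrimaryTorsion W 2)) hab)
  refine le_trans (Nat.card_le_card_of_injective
    (fun m : {m : geomPrimaryTorsion W 2 | ∀ τ ∈ κ.layerSubgroup j, τ • m = m} ↦
      (⟨m.1, fun τ hτ ↦ m.2 τ (κ.layerSubgroup_antitone hjj' hτ)⟩ :
        {m : geomPrimaryTorsion W 2 | ∀ τ ∈ κ.layerSubgroup j', τ • m = m})) ?_) h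
  intro a b hab
  exact Subtype.ext (congrArg (fun x : {m : geomPrimaryTorsion W 2 | ∀ τ ∈ κ.layerSubgroup j', τ • m = m} ↦
    (x : geomPrimaryTorsion W 2)) hab)

/-- The same with Greenberg's named finiteness fact `hB` (`E(ℚ_∞)[2^∞]` finite for the cyclotomic `κ`).
[cite: GreenbergLNM1716, §1 p. 62, §4 Lemma 4.3] -/
theorem natCard_fixedBy_layerSubgroup_le_of_le_of_hB [W.IsElliptic]
    (hB : Literature.NumberTheory.EllipticCurves.Greenberg1999.finite_torsion_cyclotomicZpExtension)
    {κ : ZpExtension ℚ 2} (hκ : κ.IsCyclotomic) {j j' t : ℕ} (hjj' : j ≤ j')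
    (h : Nat.card {m : geomPrimaryTorsion W 2 | ∀ τ ∈ κ.layerSubgroup j', τ • m = m} ≤ 2 ^ t) :
    Nat.card {m : geomPrimaryTorsion W 2 | ∀ τ ∈ κ.layerSubgroup j, τ • m = m} ≤ 2 ^ t :=
  natCard_fixedBy_layerSubgroup_le_of_le W hjj' (hB W 2 κ hκ) h

end Mono

end Summit.BirchSwinnertonDyer.BirchSwinnertonDyer.Theorems.TowerLambdaTorsion

end
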